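import Summits.AnomalousDissipation.AnomalousDissipation.Theorems.SawtoothPulseCascadeConstructionRegular58
import Summits.AnomalousDissipation.AnomalousDissipation.Theorems.SawtoothPulseCascadeK3LocalisedClosureExistence
import HarnessLib

/-!
# K3′ `K3NonlinearClosure` (aside, stmt-AnomalousDissipation-20027), line `Localised` — STUB S1 `stub_packaging`

Registered stub `stub_packaging` of the line `Localised` (reshape r1, skeleton sha `e66bacba53fb`: the packaging
layer is the tree's `SawtoothCascade.DriftFree`, box point `⟨γ, 1/4, 2, 1, ρN⟩` spelled out):

`(∀ γ ∈ Icc (4:ℝ) 8, ∀ ρN ∈ Finset.Icc 2 7, ConstructionRegular ⟨γ, 1/4, 2, 1, ρN⟩) ∧ LiftClassical ∧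
 (∀ γ ∈ Icc (4:ℝ) 8, ∀ ρN ∈ Finset.Icc 2 7, Existence ⟨γ, 1/4, 2, 1, ρN⟩)`.

All three conjuncts are ALREADY tree theorems at every admissible parameter point — the proofs landed for the
box `[5, 8]` of the DriftFree line never used `γ`:
* `Theorems.constructionRegular P` (`δ₀ > 0`, `d > 0`, `N₀ ≥ 1`, `ρN ≥ 2`; `SawtoothPulseCascadeConstructionRegular58`,
  p445324): smooth lifted datum, force jointly smooth on `[0,1) × 𝕋³`, Hölder-bounded and Hölder-continuous up to
  `t = 1`;
* `DriftFree.liftClassical` (`SawtoothCascadeDriftFree`): the `2½`-D lift of a classical planar solution is classical;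
* `Theorems.SawtoothPulseCascade.DriftFreeExistence.existence_of_params P` (same parameter hypotheses;
  `SawtoothPulseCascadeK3LocalisedClosureExistence`, p452816: Ladyzhenskaya's global 2D regularity
  `Torus.exists_classicalNS_forced_fin_two` on every closed window, glued along `[0,1)`).
So the stub on the WIDER box `γ ∈ [4, 8]` is a citation.  No new definitions, no named facts.
-/

-- `Summit.<Summit>.<Problem>`: single-conjunct summit, the duplicate namespace segment is deliberate.
set_option linter.dupNamespace false

noncomputable section

namespace Summit.AnomalousDissipation.AnomalousDissipation.Theorems.SawtoothPulseCascade.K3NonlinearClosureLocalised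

open Set
open Literature.Analysis Literature.Analysis.FluidPDE
open Literature.Analysis.FluidPDE.SawtoothCascade
open Literature.Analysis.FluidPDE.SawtoothCascade.DriftFree

/-- **STUB S1 `stub_packaging`** of line `Localised` of the aside `K3NonlinearClosure` (stmt-AnomalousDissipation-20027):
the packaging on the box `γ ∈ [4, 8]`, `ρN ∈ {2, …, 7}` (`δ₀ = ¼`, `d = 2`, `N₀ = 1`) — regularity of the explicit
force/datum (`constructionRegular`), the classical `2½`-D lift (`DriftFree.liftClassical`), and existence for every
fixed `ν > 0` (`DriftFreeExistence.existence_of_params`); none of the three depends on `γ`.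
[cite: Ladyzhenskaya1959, Thm. 1] [cite: JohanssonSorella2024, §10 (proof of Thm. 1.5), p. 45] -/
theorem stub_packaging :
    (∀ γ ∈ Icc (4 : ℝ) 8, ∀ ρN ∈ Finset.Icc 2 7, ConstructionRegular ⟨γ, 1 / 4, 2, 1, ρN⟩) ∧ LiftClassical ∧
    (∀ γ ∈ Icc (4 : ℝ) 8, ∀ ρN ∈ Finset.Icc 2 7, Existence ⟨γ, 1 / 4, 2, 1, ρN⟩) :=
  ⟨fun _ _ _ hρN => constructionRegular _ (by norm_num) (by norm_num) le_rfl (Finset.mem_Icc.1 hρN).1,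
    liftClassical,
    fun _ _ _ hρN =>
      DriftFreeExistence.existence_of_params _ (by norm_num) (by norm_num) le_rfl (Finset.mem_Icc.1 hρN).1⟩

end Summit.AnomalousDissipation.AnomalousDissipation.Theorems.SawtoothPulseCascade.K3NonlinearClosureLocalised

end
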